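import Mathlib

/-!
# Hodge-locus census, V3-XT `N = 1`: the exact 3-adic valuation law for `j(O_D)` when `3 ∥ D` — combinatorial core

HONEST FRAMING: certified instances and evidence bearing on the general Hodge conjecture; no claim.

Setting (publication cell `pub-hlocus`, engines A/B, law "T-0@3", abs-1 gen 24).  `D = D₀ f²` an imaginary
quadratic discriminant with `v₃(D) = 1` (so `3 ∣ D₀`, `3 ∤ f`), `θ = j(E)` for `E` with CM by `O_D`,
`𝔓` a prime of `L = ℚ(√D)(θ)` above `3`, `v'` the valuation with `v'(3) = 2`.  Engine B's theorem R3 says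
`v'(θ) ≥ 6`, `3 ∣ v'(θ)`, and `v'(θ - 1728) = 6`.

The exact law (engine A; derivation `code/abs_engineA/xt/n1t03/DERIVATION-T03-A.md`): `E mod 𝔓 ≅ E₀`
(`j = 0 = 1728`), `End(E₀) = O = ℤ⟨1, i, (1+j)/2, (i+k)/2⟩ ⊂ B = (-1,-3)_ℚ` (`i² = -1`, `j² = k² = -3`,
`k = ij`), `|O^×| = 12`.  Optimal embeddings `O_D ↪ O` correspond to pure quaternions
`φ = b i + c j + d k`, `b, c, d ∈ ℤ`, with `b² + 3c² + 3d² = |D|`, `c ≡ D (mod 2)`, `b ≡ d (mod 2)`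
("admissible") that are not `p •` an admissible vector for `D/p²` ("primitive"); there are `6 h(D)` of
them in `h(D)` orbits under `O^× / ±1`, one orbit per curve `E` (`𝔓` fixed)
(Deuring lifting; [cite: GrossZagier1985SingularModuli, §2–3]; the count is checked for every `D` in range).  On the deformation space `Spf W⟦t⟧` of
`E₀` (`W = W(𝔽̄₃)`), `div(j) = 3·𝒲₀(j)` (the modular function `j` has degree `|Aut E₀ / ±1| = 6` and
vanishes exactly where the automorphism `ρ = (1+j)/2` lifts, i.e. on the canonical divisor
`𝒲₀(j) ≅ Spf W₀`, `W₀ = W[√-3]`, of degree `2`), so `v'(θ_φ) = 3 · lg(W₀ / I_ℓ)` where, by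
[cite: KudlaRapoportYang2006, §3.6, (3.6.11)–(3.6.12) with r = 0] (Gross's quasi-canonical theory
[cite: Gross1986CanonicalLiftings]; Vollaard), `lg(W₀/I_ℓ) = e₀ (ℓ+1)/2` with `e₀ = 2` (`ℚ₃(√-3)`
ramified) and `ℓ = max{ℓ : φ ∈ ℤ₃[j] + Π^ℓ O₃}`; as `j` is a uniformiser `Π` of `O₃` and
`φ = c j + (b + d j) i`, `ℓ = v_Π(b + d j) = v₃(b² + 3d²)`.  Hence

  `v'(θ_φ) = vLaw0 b d := 3 (1 + v₃(b² + 3 d²)) = 6 + 3 v₃(d² + 3 b'²)`   (`b = 3b'`, forced by `3 ∣ D`).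

What THIS FILE proves (kernel-checked, sorry-free; the geometric inputs above are NOT formalised here):
* the length bookkeeping: `lgW r=0` of (3.6.11)–(3.6.12) equals `ℓ + 1` in the ramified case, and the
  dictionary `vLaw0 b d = 3 (ℓ + 1)`;
* the residue analysis: `3 ∣ b` (from `3 ∣ b² + 3c² + 3d²`), `vLaw0 = 6 + 3 v₃(d² + 3 b'²)`; `3 ∤ d ⇒ 6`;
  `3 ∣ d ⇒ ≥ 9`; and the corollary used in the bundle: if `|D|/3 ≡ 2 (mod 3)` then EVERY admissible
  vector has `3 ∤ d`, so `v'(θ) = 6` at every prime above `3` (census: `5556 / 5556` such `D`,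
  `|D| ≤ 10⁵`); if `|D|/3 ≡ 1 (mod 3)` exactly one of `c, d` is divisible by `3`;
* census anchors: for `D = -15, -39, -84, -120` the law on the sign patterns of the admissible vectors
  reproduces the certified multisets `{6,6}`, `{6,6,9,9}`, `{6,6,9,9}`, `{6,6,12,12}` (engine B SSB per
  root / engine A LOC23 per prime for `|D| ≤ 10⁴`, engine B Newton polygons above; two implementations of
  the law agree with each other and with the census on all `11111` `D` with `|D| ≤ 10⁵`, `941931` classes).
Sum over classes: `v₃(H_D(0)) = Σ_orbits vLaw0 / 2`, which agrees term by term with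
[cite: LauterViray2015SingularModuli, Thm 1.5 / Cor 1.6] for `(d₁, ℓ) = (-3, 3)` (see the derivation, §4).
-/

namespace Summit.HodgeConjecture.HodgeConjecture.HodgeLocus.Census.ValJ0At3

/-- The valuation law attached to an admissible vector `φ = b i + c j + d k`
(`b² + 3c² + 3d² = |D|`): `3 (1 + v₃(b² + 3d²))`; `c` enters only through the constraint. -/
def vLaw0 (b d : ℕ) : ℕ := 3 * (1 + padicValNat 3 (b ^ 2 + 3 * d ^ 2))

/-- The length `lg W_r(k)/I_a` of [cite: KudlaRapoportYang2006, (3.6.11)] (Vollaard's formula, stable range)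
as a function of `p`, the level `r`, the integer `a` (`ψ ∈ 𝒪_r + Π^a O_D ∖ 𝒪_r + Π^{a+1} O_D`) and the
ramification index `e_r` of (3.6.12):
`((p^{r-1} - 1)(p + 1))/(p - 1) + p^{r-1} + ((a + 1)/2 - r) e_r + 1`. -/
noncomputable def lgW (p : ℚ) (r : ℤ) (a : ℚ) (e : ℚ) : ℚ :=
  ((p ^ (r - 1) - 1) * (p + 1)) / (p - 1) + p ^ (r - 1) + ((a + 1) / 2 - r) * e + 1

/-- At level `r = 0` with `k/ℚ_p` ramified (`e₀ = 2`, (3.6.12)) the length is `a + 1`, for every `p ≠ 1`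
(here `p = 3`). [cite: KudlaRapoportYang2006, (3.6.11)–(3.6.12)] -/
theorem lgW_level_zero_ramified (a : ℚ) : lgW 3 0 a 2 = a + 1 := by
  simp only [lgW]
  norm_num

/-- Dictionary: `vLaw0 b d = 3 · lg(W₀/I_ℓ)` with `ℓ = v₃(b² + 3d²)` (multiplicity `3` of the canonical
divisor in `div(j)`, times the length at level `0`). -/
theorem vLaw0_eq_three_mul_lgW (b d : ℕ) :
    (vLaw0 b d : ℚ) = 3 * lgW 3 0 (padicValNat 3 (b ^ 2 + 3 * d ^ 2)) 2 := by
  rw [lgW_level_zero_ramified]; simp [vLaw0]; ring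

/-! ### 3-adic valuation helpers -/

/-- `v₃(n) = 0` if `3 ∤ n`. [folklore] -/
theorem v3_of_not_dvd {n : ℕ} (h : ¬ 3 ∣ n) : padicValNat 3 n = 0 :=
  padicValNat.eq_zero_of_not_dvd h

/-- `v₃(3 n) = v₃(n) + 1` for `n ≠ 0`. [folklore] -/
theorem v3_three_mul {n : ℕ} (hn : n ≠ 0) : padicValNat 3 (3 * n) = padicValNat 3 n + 1 := by
  have h3 : Fact (Nat.Prime 3) := ⟨by norm_num⟩
  rw [padicValNat.mul (by norm_num) hn, padicValNat.self (by norm_num)]; ring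

/-! ### Residue analysis -/

/-- From the constraint: `3 ∣ b² + 3c² + 3d²` forces `3 ∣ b`. -/
theorem three_dvd_b {b c d M : ℕ} (h : b ^ 2 + 3 * c ^ 2 + 3 * d ^ 2 = 3 * M) : 3 ∣ b := by
  have h1 : 3 ∣ 3 * (c ^ 2 + d ^ 2) + b ^ 2 := ⟨M, by linarith⟩
  have h3 : 3 ∣ b ^ 2 := (Nat.dvd_add_right (dvd_mul_right 3 _)).mp h1
  exact Nat.Prime.dvd_of_dvd_pow (by norm_num : Nat.Prime 3) h3

/-- With `b = 3 b'`: `vLaw0 (3b') d = 6 + 3 v₃(d² + 3 b'²)`. -/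
theorem vLaw0_three_mul (b' d : ℕ) (h : d ^ 2 + 3 * b' ^ 2 ≠ 0) :
    vLaw0 (3 * b') d = 6 + 3 * padicValNat 3 (d ^ 2 + 3 * b' ^ 2) := by
  have e : (3 * b') ^ 2 + 3 * d ^ 2 = 3 * (d ^ 2 + 3 * b' ^ 2) := by ring
  simp only [vLaw0, e, v3_three_mul h]; ring

/-- `3 ∣ b`, `3 ∤ d` ⇒ the law gives `6`. -/
theorem vLaw0_eq_six {b d : ℕ} (hb : 3 ∣ b) (hd : ¬ 3 ∣ d) : vLaw0 b d = 6 := by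
  obtain ⟨b', rfl⟩ := hb
  have hne : d ^ 2 + 3 * b' ^ 2 ≠ 0 := by
    intro h0
    have : d = 0 := by nlinarith [sq_nonneg d]
    exact hd (this ▸ dvd_zero 3)
  rw [vLaw0_three_mul b' d hne, v3_of_not_dvd]
  intro h3
  apply hd
  have : 3 ∣ d ^ 2 := by
    have h' : (3 : ℕ) ∣ 3 * b' ^ 2 := ⟨b' ^ 2, rfl⟩
    exact (Nat.dvd_add_left h').mp h3
  exact Nat.Prime.dvd_of_dvd_pow (by norm_num) this

/-- `3 ∣ b`, `3 ∣ d`, `(b,d) ≠ (0,0)` ⇒ the law gives at least `9`. -/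
theorem nine_le_vLaw0 {b d : ℕ} (hb : 3 ∣ b) (hd : 3 ∣ d) (hne : b ^ 2 + 3 * d ^ 2 ≠ 0) : 9 ≤ vLaw0 b d := by
  obtain ⟨b', rfl⟩ := hb
  obtain ⟨d', rfl⟩ := hd
  have h3 : Fact (Nat.Prime 3) := ⟨by norm_num⟩
  have e : (3 * b') ^ 2 + 3 * (3 * d') ^ 2 = 3 ^ 2 * (b' ^ 2 + 3 * d' ^ 2) := by ring
  have hne' : b' ^ 2 + 3 * d' ^ 2 ≠ 0 := by
    intro h0; apply hne; rw [e, h0]; norm_num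
  have : 2 ≤ padicValNat 3 ((3 * b') ^ 2 + 3 * (3 * d') ^ 2) := by
    rw [e, padicValNat.mul (by norm_num) hne', padicValNat.prime_pow]; omega
  simp only [vLaw0]; omega

/-- The `mod 3` sorting of an admissible vector.  Write `|D| = 3M` (`3 ∤ M` since `v₃(D) = 1`) and
`b = 3b'`, so `M = 3b'² + c² + d²`.  If `M ≡ 2 (mod 3)` then `3 ∤ c` and `3 ∤ d`. -/
theorem not_three_dvd_of_M_mod_three_eq_two {b' c d M : ℕ} (h : 3 * b' ^ 2 + c ^ 2 + d ^ 2 = M)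
    (hM : M % 3 = 2) : ¬ 3 ∣ c ∧ ¬ 3 ∣ d := by
  have key : ∀ x y : ZMod 3, x ^ 2 + y ^ 2 = 2 → x ≠ 0 ∧ y ≠ 0 := by decide
  have hc : ((c : ZMod 3)) ^ 2 + ((d : ZMod 3)) ^ 2 = 2 := by
    have : ((3 * b' ^ 2 + c ^ 2 + d ^ 2 : ℕ) : ZMod 3) = ((M : ℕ) : ZMod 3) := by rw [h]
    push_cast at this
    have h3 : (3 : ZMod 3) = 0 := by decide
    rw [h3, zero_mul, zero_add] at this
    rw [this, ← Nat.mod_add_div M 3, hM]; push_cast; rw [h3]; ring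
  obtain ⟨h1, h2⟩ := key _ _ hc
  refine ⟨fun h3 => h1 ?_, fun h3 => h2 ?_⟩
  · exact (ZMod.natCast_eq_zero_iff c 3).mpr h3
  · exact (ZMod.natCast_eq_zero_iff d 3).mpr h3

/-- If `M ≡ 1 (mod 3)` then exactly one of `c, d` is divisible by `3`. -/
theorem exactly_one_dvd_of_M_mod_three_eq_one {b' c d M : ℕ} (h : 3 * b' ^ 2 + c ^ 2 + d ^ 2 = M)
    (hM : M % 3 = 1) : (3 ∣ c ∧ ¬ 3 ∣ d) ∨ (¬ 3 ∣ c ∧ 3 ∣ d) := by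
  have key : ∀ x y : ZMod 3, x ^ 2 + y ^ 2 = 1 → (x = 0 ∧ y ≠ 0) ∨ (x ≠ 0 ∧ y = 0) := by decide
  have hc : ((c : ZMod 3)) ^ 2 + ((d : ZMod 3)) ^ 2 = 1 := by
    have : ((3 * b' ^ 2 + c ^ 2 + d ^ 2 : ℕ) : ZMod 3) = ((M : ℕ) : ZMod 3) := by rw [h]
    push_cast at this
    have h3 : (3 : ZMod 3) = 0 := by decide
    rw [h3, zero_mul, zero_add] at this
    rw [this, ← Nat.mod_add_div M 3, hM]; push_cast; rw [h3]; ring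
  rcases key _ _ hc with ⟨h1, h2⟩ | ⟨h1, h2⟩
  · left; exact ⟨(ZMod.natCast_eq_zero_iff c 3).mp h1, fun h3 => h2 ((ZMod.natCast_eq_zero_iff d 3).mpr h3)⟩
  · right; exact ⟨fun h3 => h1 ((ZMod.natCast_eq_zero_iff c 3).mpr h3), (ZMod.natCast_eq_zero_iff d 3).mp h2⟩

/-- COROLLARY (the bundle's "all-6" law): if `b² + 3c² + 3d² = |D| = 3M` with `M ≡ 2 (mod 3)`, then
`vLaw0 b d = 6` — i.e. `v'(θ) = 6` at every prime of `L` above `3` for every such `D`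
(census: `5556 / 5556` discriminants with `|D| ≤ 10⁵`, both engines). -/
theorem vLaw0_eq_six_of_M_mod_three_eq_two {b c d M : ℕ} (h : b ^ 2 + 3 * c ^ 2 + 3 * d ^ 2 = 3 * M)
    (hM : M % 3 = 2) : vLaw0 b d = 6 := by
  have hb := three_dvd_b h
  obtain ⟨b', rfl⟩ := hb
  have h' : 3 * b' ^ 2 + c ^ 2 + d ^ 2 = M := by nlinarith [h]
  exact vLaw0_eq_six ⟨b', rfl⟩ (not_three_dvd_of_M_mod_three_eq_two h' hM).2

/-! ### Census anchors

For each anchor `D` we list the sign patterns `(|b|, |c|, |d|)` of the `6 h(D)` admissible vectors (engine A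
impl-1 enumeration), the number of vectors in each pattern, and the value of the law; the orbits of
`O^× / ±1` have size `6` and the law is constant on orbits (`b² + 3d²` is the norm form of `ℤ[j] ∩ …`,
invariant under conjugation by the units), so the class multiset is read off from the counts.
Certified multisets (engine B SSB per root / engine A LOC23 per prime; impl-1 = impl-2):
`D = -15`: `{6,6}`; `D = -39`: `{6,6,9,9}`; `D = -84`: `{6,6,9,9}`; `D = -120`: `{6,6,12,12}`. -/

/-- `v₃(12) = 1`. -/
theorem v3_twelve : padicValNat 3 12 = 1 := by
  rw [show (12 : ℕ) = 3 * 4 by norm_num, v3_three_mul (by norm_num), v3_of_not_dvd (by norm_num)]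

/-- `v₃(36) = 2`. -/
theorem v3_thirtysix : padicValNat 3 36 = 2 := by
  rw [show (36 : ℕ) = 3 * 12 by norm_num, v3_three_mul (by norm_num), v3_twelve]

/-- `D = -15` (`h = 2`; `12` vectors): patterns `(0,1,2)` ×4 and `(3,1,1)` ×8, both value `6` ⇒ `{6,6}`. -/
theorem anchor_D15 : 0 ^ 2 + 3 * 1 ^ 2 + 3 * 2 ^ 2 = 15 ∧ 3 ^ 2 + 3 * 1 ^ 2 + 3 * 1 ^ 2 = 15 ∧
    vLaw0 0 2 = 6 ∧ vLaw0 3 1 = 6 :=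
  ⟨by norm_num, by norm_num, vLaw0_eq_six ⟨0, rfl⟩ (by norm_num), vLaw0_eq_six ⟨1, rfl⟩ (by norm_num)⟩

/-- `D = -39` (`h = 4`; `24` vectors): `(0,3,2)` ×4 ↦ `6`, `(3,3,1)` ×8 ↦ `6`, `(6,1,0)` ×4 ↦ `9`,
`(3,1,3)` ×8 ↦ `9`; `12` vectors each ⇒ `{6,6,9,9}`. -/
theorem anchor_D39 : 0 ^ 2 + 3 * 3 ^ 2 + 3 * 2 ^ 2 = 39 ∧ 3 ^ 2 + 3 * 3 ^ 2 + 3 * 1 ^ 2 = 39 ∧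
    6 ^ 2 + 3 * 1 ^ 2 + 3 * 0 ^ 2 = 39 ∧ 3 ^ 2 + 3 * 1 ^ 2 + 3 * 3 ^ 2 = 39 ∧
    vLaw0 0 2 = 6 ∧ vLaw0 3 1 = 6 ∧ vLaw0 6 0 = 9 ∧ vLaw0 3 3 = 9 := by
  refine ⟨by norm_num, by norm_num, by norm_num, by norm_num, vLaw0_eq_six ⟨0, rfl⟩ (by norm_num),
    vLaw0_eq_six ⟨1, rfl⟩ (by norm_num), ?_, ?_⟩
  · rw [show (6 : ℕ) = 3 * 2 by norm_num, vLaw0_three_mul 2 0 (by norm_num)]; norm_num [v3_twelve]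
  · rw [show (3 : ℕ) = 3 * 1 by norm_num, vLaw0_three_mul 1 3 (by norm_num)]; norm_num [v3_twelve]

/-- `D = -84` (`h = 4`; `24` vectors): `(3,0,5)` ×4 ↦ `6`, `(9,0,1)` ×4 ↦ `6`, `(6,0,4)` ×4 ↦ `6`,
`(6,4,0)` ×4 ↦ `9`, `(3,4,3)` ×8 ↦ `9`; `12 + 12` ⇒ `{6,6,9,9}`. -/
theorem anchor_D84 : 3 ^ 2 + 3 * 0 ^ 2 + 3 * 5 ^ 2 = 84 ∧ 9 ^ 2 + 3 * 0 ^ 2 + 3 * 1 ^ 2 = 84 ∧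
    6 ^ 2 + 3 * 0 ^ 2 + 3 * 4 ^ 2 = 84 ∧ 6 ^ 2 + 3 * 4 ^ 2 + 3 * 0 ^ 2 = 84 ∧ 3 ^ 2 + 3 * 4 ^ 2 + 3 * 3 ^ 2 = 84 ∧
    vLaw0 3 5 = 6 ∧ vLaw0 9 1 = 6 ∧ vLaw0 6 4 = 6 ∧ vLaw0 6 0 = 9 ∧ vLaw0 3 3 = 9 := by
  refine ⟨by norm_num, by norm_num, by norm_num, by norm_num, by norm_num, vLaw0_eq_six ⟨1, rfl⟩ (by norm_num),
    vLaw0_eq_six ⟨3, rfl⟩ (by norm_num), vLaw0_eq_six ⟨2, rfl⟩ (by norm_num), ?_, ?_⟩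
  · rw [show (6 : ℕ) = 3 * 2 by norm_num, vLaw0_three_mul 2 0 (by norm_num)]; norm_num [v3_twelve]
  · rw [show (3 : ℕ) = 3 * 1 by norm_num, vLaw0_three_mul 1 3 (by norm_num)]; norm_num [v3_twelve]

/-- `D = -120` (`h = 4`; `24` vectors): `(0,6,2)` ×4 ↦ `6`, `(3,6,1)` ×8 ↦ `6`, `(0,2,6)` ×4 ↦ `12`,
`(9,2,3)` ×8 ↦ `12`; ⇒ `{6,6,12,12}`. -/
theorem anchor_D120 : 0 ^ 2 + 3 * 6 ^ 2 + 3 * 2 ^ 2 = 120 ∧ 3 ^ 2 + 3 * 6 ^ 2 + 3 * 1 ^ 2 = 120 ∧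
    0 ^ 2 + 3 * 2 ^ 2 + 3 * 6 ^ 2 = 120 ∧ 9 ^ 2 + 3 * 2 ^ 2 + 3 * 3 ^ 2 = 120 ∧
    vLaw0 0 2 = 6 ∧ vLaw0 3 1 = 6 ∧ vLaw0 0 6 = 12 ∧ vLaw0 9 3 = 12 := by
  refine ⟨by norm_num, by norm_num, by norm_num, by norm_num, vLaw0_eq_six ⟨0, rfl⟩ (by norm_num),
    vLaw0_eq_six ⟨1, rfl⟩ (by norm_num), ?_, ?_⟩
  · rw [show (0 : ℕ) = 3 * 0 by norm_num, vLaw0_three_mul 0 6 (by norm_num)]; norm_num [v3_thirtysix]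
  · rw [show (9 : ℕ) = 3 * 3 by norm_num, vLaw0_three_mul 3 3 (by norm_num)]; norm_num [v3_thirtysix]

/-- Global corollary at the anchors: `v₃(H_D(0)) = ½ Σ_orbits vLaw0`: `-15 ↦ 6`, `-39 ↦ 15`, `-84 ↦ 15`,
`-120 ↦ 18` (certified: engine A LOC23 `vN0`, engine B; and `= ` the Lauter–Viray sum for `(d₁,ℓ) = (-3,3)`). -/
theorem anchors_global : (6 + 6) / 2 = (6 : ℕ) ∧ (6 + 6 + 9 + 9) / 2 = (15 : ℕ) ∧ (6 + 6 + 12 + 12) / 2 = (18 : ℕ) := by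
  decide

end Summit.HodgeConjecture.HodgeConjecture.HodgeLocus.Census.ValJ0At3
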